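import Summits.NavierStokesRegularity.NavierStokesRegularity.Theorems.PerpetualPumpEulerTypeIGlueDensity
import Summits.NavierStokesRegularity.NavierStokesRegularity.Theorems.PerpetualPumpEulerTypeIGlueSobolevR3
import Literature.Analysis.FluidPDE.TaoLocalisationHolds

/-!
# Route PerpetualPump · `EulerTypeIGlue` — stub `stub_memH10` (line `Sketch`)

`H¹⁰_df` membership of the slices of the complexified curve of a classical Leray–Hopf solution:
if `(u, p)` is a classical solution of the unforced Navier–Stokes system (viscosity `ν > 0`) on
`[0, T) × ℝ³`, Leray–Hopf from its rapidly decaying datum `u 0`, and `U t ∈ L²(ℝ³; ℂ³)` is any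
`L²` class with `⇑(U t) = (u t)^ℂ` a.e. for `t ∈ [0, T)`, then `U t ∈ H¹⁰_df(ℝ³)` (Tao's
`MemH10df`: `‖·‖_{H¹⁰} < ∞`, real, Fourier-divergence-free) for every `t ∈ [0, T)`.

Proof: for `t ∈ [0, T)` restrict `u` to the closed slab `[0, T₁]`, `T₁ = (t + T)/2 ∈ (t, T)`;
there the energy is bounded by the initial energy (`IsLerayHopfOn.lintegral_enorm_sq_le`,
Leray 1934, (5.2)), so Tao's slab theorem (`tao2011_hasBoundedSobolevNormsOn_holds`; Tao 2013,
arXiv:1108.1165, Cor. 11.1 + Cor. 4.3 + Thm. 5.4 (iv), a theorem of the tree) bounds all spatial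
`L²` Sobolev norms of `u t`; `u t` is smooth and divergence free (classical solution), and
`(u t)^ℂ ∈ L²` (`IsLerayHopfOn.memLp`), so the landed `memH10df_toLp_complexify` gives
`[(u t)^ℂ] ∈ H¹⁰_df`; finally `U t = [(u t)^ℂ]` as `L²` classes.

## References

* T. Tao, J. Amer. Math. Soc. 29 (2016), arXiv:1402.0290v3, §1.1 p. 3 (`H¹⁰_df`). [Tao2016AveragedNS]
* T. Tao, Anal. PDE 6 (2013), arXiv:1108.1165, Cor. 11.1 + Cor. 4.3 + Thm. 5.4 (iv). [Tao2011]
-/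

noncomputable section

open MeasureTheory Set Filter Topology FourierTransform
open scoped ENNReal NNReal RealInnerProductSpace SchwartzMap ContDiff

set_option linter.dupNamespace false

namespace Summit.NavierStokesRegularity.NavierStokesRegularity.Theorems.PerpetualPumpEulerTypeIGlue

open Literature.Analysis.FluidPDE Literature.Analysis.FluidPDE.Tao2016
open Literature.Analysis.FunctionSpaces (eFourierSobolevNorm)
open Literature.Analysis.FunctionSpaces.EuclideanSpace (complexify complexify_apply norm_complexify
  continuous_complexify)

/-- Local notation for physical / frequency space `ℝ³`. -/
local notation "ℝ³" => EuclideanSpace ℝ (Fin 3)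
/-- Local notation for the complexified range `ℂ³`. -/
local notation "ℂ³" => EuclideanSpace ℂ (Fin 3)

/-- **All spatial Sobolev norms of a slice are finite**: for a classical unforced solution
`(u, p)` on `[0, T) × ℝ³` (viscosity `ν > 0`) which is Leray–Hopf from its rapidly decaying datum,
`∫ ‖Dʲ(u t)‖² < ∞` for every `j` and every `t ∈ [0, T)` (Tao's slab theorem on the closed slab
`[0, (t + T)/2]`, where the energy is bounded by the initial energy).
[cite: Tao2011, Cor. 11.1 + Cor. 4.3 + Thm. 5.4 (iv)] -/
theorem lintegral_enorm_iteratedFDeriv_sq_lt_top_of_classical_lerayHopf {ν T : ℝ} (hν : 0 < ν)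
    {u : ℝ → ℝ³ → ℝ³} {p : ℝ → ℝ³ → ℝ} (hcl : IsClassicalNSSolutionOn (Ico 0 T) ν 0 u p)
    (hLH : IsLerayHopfOn T ν 0 (u 0) u) (hdec : HasRapidSpatialDecay (u 0)) {t : ℝ}
    (ht : t ∈ Ico 0 T) (j : ℕ) : ∫⁻ x, ‖iteratedFDeriv ℝ j (u t) x‖ₑ ^ 2 < ⊤ := by
  -- the closed slab `[0, T₁]`, `t < T₁ < T`
  set T₁ : ℝ := (t + T) / 2 with hT₁_def
  have htT₁ : t < T₁ := by rw [hT₁_def]; linarith [ht.2]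
  have hT₁T : T₁ < T := by rw [hT₁_def]; linarith [ht.2]
  have hT₁pos : 0 < T₁ := lt_of_le_of_lt ht.1 htT₁
  have hsol₁ : IsClassicalNSSolutionOn (Icc 0 T₁) ν 0 u p :=
    hcl.mono (Icc_subset_Ico_right hT₁T) (uniqueDiffOn_Icc hT₁pos)
  -- energy bounded by the initial energy on `[0, T₁] ⊆ [0, T]`
  have hEn : ∃ C : ℝ≥0, ∀ s ∈ Icc 0 T₁, ∫⁻ x, ‖u s x‖ₑ ^ 2 ≤ C :=
    ⟨(2 * VectorCalculus.kineticEnergy (u 0)).toNNReal, fun s hs =>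
      hLH.lintegral_enorm_sq_le hν.le ⟨hs.1, hs.2.trans hT₁T.le⟩⟩
  -- Tao 2011, Cor. 11.1: all Sobolev norms bounded on the closed slab
  have hH : HasBoundedSobolevNormsOn (Icc 0 T₁) u :=
    tao2011_hasBoundedSobolevNormsOn_holds hν hT₁pos hsol₁ hEn hdec
  obtain ⟨C, hC⟩ := hH j
  exact (hC t ⟨ht.1, htT₁.le⟩).trans_lt ENNReal.coe_lt_top

/-- **S4 — `H¹⁰_df` membership of the slices**: for a classical unforced solution `(u, p)` on
`[0, T) × ℝ³` (viscosity `ν > 0`), Leray–Hopf from its rapidly decaying datum, and any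
`U : ℝ → L²(ℝ³; ℂ³)` with `⇑(U t) = (u t)^ℂ` a.e. for `t ∈ [0, T)`, every slice `U t`,
`t ∈ [0, T)`, lies in Tao's class `H¹⁰_df(ℝ³)` (slab Sobolev bounds
`tao2011_hasBoundedSobolevNormsOn_holds` + the landed `memH10df_toLp_complexify`).
[cite: Tao2016AveragedNS, §1.1 p. 3] -/
theorem stub_memH10 {ν T : ℝ} (hν : 0 < ν) {u : ℝ → ℝ³ → ℝ³} {p : ℝ → ℝ³ → ℝ}
    (hcl : IsClassicalNSSolutionOn (Ico 0 T) ν 0 u p) (hLH : IsLerayHopfOn T ν 0 (u 0) u)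
    (hdec : HasRapidSpatialDecay (u 0)) (U : ℝ → L2C)
    (hU : ∀ t ∈ Ico 0 T, ((U t : L2C) : ℝ³ → ℂ³) =ᵐ[volume] complexify ∘ u t) :
    ∀ t ∈ Ico 0 T, MemH10df (U t) := by
  intro t ht
  have hint : ∀ j ≤ 10, ∫⁻ x, ‖iteratedFDeriv ℝ j (u t) x‖ₑ ^ 2 < ⊤ := fun j _ =>
    lintegral_enorm_iteratedFDeriv_sq_lt_top_of_classical_lerayHopf hν hcl hLH hdec ht j
  have h2 : MemLp (complexify ∘ u t) 2 (volume : Measure ℝ³) :=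
    memLp_complexify_of_memLp (hLH.memLp t ⟨ht.1, ht.2.le⟩)
  have hmem : MemH10df (h2.toLp _) :=
    memH10df_toLp_complexify (hcl.contDiff_velocity ht) (hcl.divFree t ht) hint h2
  have hUt : U t = h2.toLp _ := Lp.ext ((hU t ht).trans h2.coeFn_toLp.symm)
  rw [hUt]
  exact hmem

end Summit.NavierStokesRegularity.NavierStokesRegularity.Theorems.PerpetualPumpEulerTypeIGlue

end
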